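import Summits.AnomalousDissipation.AnomalousDissipation.Theorems.SawtoothPulseCascadeK3LocalisedClosureForceBound
import Literature.Analysis.FluidPDE.DEIJShearStage

/-!
# The planar force `∂ₜū` of the sawtooth pulse cascade on each half-slot, and the lifted force as a
# shear drift on `𝕋³`

Route `AnomalousDissipation/SawtoothPulseCascade`, crux K3loc (stmt-AnomalousDissipation-19492), registered
line `DriftFree` (v3): support lemmas for stub S1 `stub_packaging`, conjunct (a) `ConstructionRegular`
(proved in `SawtoothPulseCascadeConstructionRegular58`), about the EXPLICIT objects of
`Literature.Analysis.FluidPDE.SawtoothCascade` / `…SawtoothCascadeDriftFree`; builds on the lead prover's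
force-bound helper `SawtoothPulseCascadeK3LocalisedClosureForceBound` (`Rates.deriv_rateH/V_eq_zero`,
`Rates.abs_U_le`, `Rates.abs_deriv_rateH/V_le`, `exists_abs_deriv_bump_le` are reused, not restated):

* `Cascade.hasDerivAt_field_apply`, `Cascade.timeDerivWithin_field` — below `tStart J` only the phases
  `j < J` are active, so `τ ↦ ū(τ, x)` is differentiable with derivative
  `(Σ_{j<J} rateH_j′ U_j(x₂)) e₀ + (Σ_{j<J} rateV_j′ U_j(x₁)) e₁` (vector form), and this is the one-sided
  time derivative within `[0, 1)`;
* `Cascade.planarForce_of_mem_H` / `_of_mem_V` — on the CLOSED H (resp. V) half-slot of phase `j` the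
  planar force `planarForce P t = ∂ₜū(t)` is the single shear `rateH_j′(t) U_j(x₂) e₀`
  (resp. `rateV_j′(t) U_j(x₁) e₁`): every other pulse rate has vanishing derivative there;
  `planarForce_of_one_le`, `liftedForce_of_one_le` — the force is `0` from `t = 1` on;
* `Cascade.abs_U_le` — `|U_j| ≤ 1/(4N_j)` (the lead's `(π/2)/(2πN_j)` simplified);
* `Cascade.liftedForce_of_mem_H` / `_of_mem_V` — on each half-slot the lifted force `(∂ₜū, 0) ∘ π` on `𝕋³`
  IS a shear drift `Torus.DEIJ.drift p q ⟨U_j⟩ (rate′)` of the tree's DEIJ regularity toolkit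
  (`DEIJShearStage` / `DEIJDriftRegularity`), whose `C^{0,r}` norms are controlled by interpolation.

All statements are about tree definitions; no new definitions, no named facts.
-/

-- `Summit.<Summit>.<Problem>` is the tree's mandated summit-side namespace (CONVENTIONS §2); for this
-- single-conjunct summit the two coincide, so the duplicate is deliberate (lakefile: off for `Summits`).
set_option linter.dupNamespace false

noncomputable section

open MeasureTheory Set Filter Topology
open scoped NNReal ENNReal ContDiff
open Literature.Analysis Literature.Analysis.FunctionSpaces Literature.Analysis.FluidPDE
open Literature.Analysis.FluidPDE.SawtoothCascade
open Literature.Analysis.FluidPDE.SawtoothCascade.DriftFree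
open Literature.Analysis.FunctionSpaces.Torus (twoHalf planarProj)

namespace Summit.AnomalousDissipation.AnomalousDissipation.Theorems

/-! ## The pulse rates: where their derivatives vanish, and how large they are -/

namespace Cascade

open CascadeParams

variable (P : CascadeParams)

/-- `tStart` is monotone. -/
theorem tStart_mono : Monotone tStart := tStart_strictMono.monotone

/-- The H half-slot of phase `i` ends before phase `i + 1` starts. -/
theorem tStart_add_tHalf_le_tStart_succ (i : ℕ) : tStart i + tHalf i ≤ tStart (i + 1) := by
  rw [tStart_succ]; linarith [tHalf_pos i]

/-- `rateH j` is differentiable. -/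
theorem differentiableAt_rateH (j : ℕ) (t : ℝ) : DifferentiableAt ℝ (P.rateH j) t :=
  ((P.contDiff_rateH j).differentiable (by simp)).differentiableAt

/-- `rateV j` is differentiable. -/
theorem differentiableAt_rateV (j : ℕ) (t : ℝ) : DifferentiableAt ℝ (P.rateV j) t :=
  ((P.contDiff_rateV j).differentiable (by simp)).differentiableAt

/-- `(rateH j)′ = 0` from the end of the H half-slot of phase `j` on (lead's `Rates.deriv_rateH_eq_zero`). -/
theorem deriv_rateH_eq_zero_of_ge {j : ℕ} {t : ℝ} (ht : tStart j + tHalf j ≤ t) :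
    deriv (P.rateH j) t = 0 :=
  SawtoothPulseCascade.DriftFreeClosure.Rates.deriv_rateH_eq_zero P fun h => (not_lt.2 ht) h.2

/-- `(rateH j)′ = 0` up to the start of phase `j`. -/
theorem deriv_rateH_eq_zero_of_le {j : ℕ} {t : ℝ} (ht : t ≤ tStart j) : deriv (P.rateH j) t = 0 :=
  SawtoothPulseCascade.DriftFreeClosure.Rates.deriv_rateH_eq_zero P fun h => (not_lt.2 ht) h.1

/-- `(rateV j)′ = 0` up to the start of the V half-slot of phase `j`. -/
theorem deriv_rateV_eq_zero_of_le {j : ℕ} {t : ℝ} (ht : t ≤ tStart j + tHalf j) :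
    deriv (P.rateV j) t = 0 :=
  SawtoothPulseCascade.DriftFreeClosure.Rates.deriv_rateV_eq_zero P fun h => (not_lt.2 ht) h.1

/-- `(rateV j)′ = 0` from the start of phase `j + 1` on. -/
theorem deriv_rateV_eq_zero_of_ge {j : ℕ} {t : ℝ} (ht : tStart (j + 1) ≤ t) : deriv (P.rateV j) t = 0 :=
  SawtoothPulseCascade.DriftFreeClosure.Rates.deriv_rateV_eq_zero P fun h => (not_lt.2 ht) h.2

/-! ## The time derivative of the cascade field -/

/-- The cascade field written on the standard basis: `ū = (Σ rateH·U(x₂)) e₀ + (Σ rateV·U(x₁)) e₁`. -/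
theorem field_eq_smul_add_smul (t : ℝ) (x : UnitAddTorus (Fin 2)) :
    P.field t x = (∑' j, P.rateH j t * P.U j (Torus.repr x 1)) • EuclideanSpace.single 0 (1 : ℝ) +
      (∑' j, P.rateV j t * P.U j (Torus.repr x 0)) • EuclideanSpace.single 1 (1 : ℝ) := by
  ext i
  fin_cases i <;> simp [CascadeParams.field]

/-- Below `tStart J` only the phases `j < J` are active, so `τ ↦ ū(τ, x)` is differentiable at `t` with
derivative `(Σ_{j<J} rateH_j′(t) U_j(x₂)) e₀ + (Σ_{j<J} rateV_j′(t) U_j(x₁)) e₁`. -/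
theorem hasDerivAt_field_apply {J : ℕ} {t : ℝ} (ht : t < tStart J) (x : UnitAddTorus (Fin 2)) :
    HasDerivAt (fun τ => P.field τ x)
      ((∑ j ∈ Finset.range J, deriv (P.rateH j) t * P.U j (Torus.repr x 1)) • EuclideanSpace.single 0 (1 : ℝ) +
        (∑ j ∈ Finset.range J, deriv (P.rateV j) t * P.U j (Torus.repr x 0)) •
          EuclideanSpace.single 1 (1 : ℝ)) t := by
  have hH : HasDerivAt (fun τ => ∑ j ∈ Finset.range J, P.rateH j τ * P.U j (Torus.repr x 1))
      (∑ j ∈ Finset.range J, deriv (P.rateH j) t * P.U j (Torus.repr x 1)) t :=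
    HasDerivAt.fun_sum fun j _ => ((differentiableAt_rateH P j t).hasDerivAt).mul_const _
  have hV : HasDerivAt (fun τ => ∑ j ∈ Finset.range J, P.rateV j τ * P.U j (Torus.repr x 0))
      (∑ j ∈ Finset.range J, deriv (P.rateV j) t * P.U j (Torus.repr x 0)) t :=
    HasDerivAt.fun_sum fun j _ => ((differentiableAt_rateV P j t).hasDerivAt).mul_const _
  have h := (hH.smul_const (EuclideanSpace.single (0 : Fin 2) (1 : ℝ))).fun_add
    (hV.smul_const (EuclideanSpace.single (1 : Fin 2) (1 : ℝ)))
  refine h.congr_of_eventuallyEq ?_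
  filter_upwards [Iio_mem_nhds ht] with τ hτ
  rw [field_eq_smul_add_smul P, P.tsum_rateH_eq_sum_of_lt hτ, P.tsum_rateV_eq_sum_of_lt hτ]

/-- The time derivative of the cascade field within `[0, 1)`, at `0 ≤ t < tStart J`. -/
theorem timeDerivWithin_field {J : ℕ} {t : ℝ} (ht0 : 0 ≤ t) (ht : t < tStart J) (x : UnitAddTorus (Fin 2)) :
    Torus.timeDerivWithin (Ico 0 1) P.field t x =
      (∑ j ∈ Finset.range J, deriv (P.rateH j) t * P.U j (Torus.repr x 1)) • EuclideanSpace.single 0 (1 : ℝ) +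
        (∑ j ∈ Finset.range J, deriv (P.rateV j) t * P.U j (Torus.repr x 0)) •
          EuclideanSpace.single 1 (1 : ℝ) :=
  (hasDerivAt_field_apply P ht x).hasDerivWithinAt.derivWithin
    (uniqueDiffOn_Ico (0 : ℝ) 1 t ⟨ht0, ht.trans (tStart_lt_one J)⟩)

/-- **The planar force on the H half-slot of phase `j`** is the single shear `rateH_j′(t) U_j(x₂) e₀`. -/
theorem planarForce_of_mem_H {j : ℕ} {t : ℝ} (ht : t ∈ Icc (tStart j) (tStart j + tHalf j)) :
    planarForce P t = fun y => (deriv (P.rateH j) t * P.U j (Torus.repr y 1)) • EuclideanSpace.single 0 (1 : ℝ) := by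
  have ht0 : 0 ≤ t := (tStart_nonneg j).trans ht.1
  have htJ : t < tStart (j + 1) := by rw [tStart_succ]; linarith [ht.2, tHalf_pos j]
  have ht1 : t < 1 := htJ.trans (tStart_lt_one _)
  funext y
  rw [planarForce, if_pos ht1, timeDerivWithin_field P ht0 htJ y]
  have hH : ∑ i ∈ Finset.range (j + 1), deriv (P.rateH i) t * P.U i (Torus.repr y 1) =
      deriv (P.rateH j) t * P.U j (Torus.repr y 1) := by
    rw [Finset.sum_range_succ, Finset.sum_eq_zero (fun i hi => ?_), zero_add]
    have hi : i < j := Finset.mem_range.1 hi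
    rw [deriv_rateH_eq_zero_of_ge P (((tStart_add_tHalf_le_tStart_succ i).trans
      (tStart_mono (Nat.succ_le_of_lt hi))).trans ht.1), zero_mul]
  have hV : ∑ i ∈ Finset.range (j + 1), deriv (P.rateV i) t * P.U i (Torus.repr y 0) = 0 := by
    refine Finset.sum_eq_zero fun i hi => ?_
    have hi : i < j + 1 := Finset.mem_range.1 hi
    rcases (Nat.lt_succ_iff.1 hi).eq_or_lt with rfl | hij
    · rw [deriv_rateV_eq_zero_of_le P ht.2, zero_mul]
    · rw [deriv_rateV_eq_zero_of_ge P ((tStart_mono (Nat.succ_le_of_lt hij)).trans ht.1), zero_mul]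
  rw [hH, hV, zero_smul, add_zero]

/-- **The planar force on the V half-slot of phase `j`** is the single shear `rateV_j′(t) U_j(x₁) e₁`. -/
theorem planarForce_of_mem_V {j : ℕ} {t : ℝ} (ht : t ∈ Icc (tStart j + tHalf j) (tStart (j + 1))) :
    planarForce P t = fun y => (deriv (P.rateV j) t * P.U j (Torus.repr y 0)) • EuclideanSpace.single 1 (1 : ℝ) := by
  have ht0 : 0 ≤ t := (tStart_nonneg j).trans ((le_add_of_nonneg_right (tHalf_pos j).le).trans ht.1)
  have htJ : t < tStart (j + 2) := ht.2.trans_lt (tStart_strictMono (Nat.lt_succ_self _))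
  have ht1 : t < 1 := htJ.trans (tStart_lt_one _)
  funext y
  rw [planarForce, if_pos ht1, timeDerivWithin_field P ht0 htJ y]
  have hH : ∑ i ∈ Finset.range (j + 2), deriv (P.rateH i) t * P.U i (Torus.repr y 1) = 0 := by
    refine Finset.sum_eq_zero fun i hi => ?_
    have hi : i < j + 2 := Finset.mem_range.1 hi
    rcases lt_or_ge i (j + 1) with hij | hij
    · -- `i ≤ j`: its H half-slot is over
      rw [deriv_rateH_eq_zero_of_ge P, zero_mul]
      rcases (Nat.lt_succ_iff.1 hij).eq_or_lt with rfl | hij'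
      · exact ht.1
      · exact ((tStart_add_tHalf_le_tStart_succ i).trans (tStart_mono (Nat.succ_le_of_lt hij'))).trans
          ((le_add_of_nonneg_right (tHalf_pos _).le).trans ht.1)
    · -- `i = j + 1`: not started
      obtain rfl : i = j + 1 := le_antisymm (Nat.lt_succ_iff.1 hi) hij
      rw [deriv_rateH_eq_zero_of_le P ht.2, zero_mul]
  have hV : ∑ i ∈ Finset.range (j + 2), deriv (P.rateV i) t * P.U i (Torus.repr y 0) =
      deriv (P.rateV j) t * P.U j (Torus.repr y 0) := by
    rw [Finset.sum_range_succ, Finset.sum_range_succ, Finset.sum_eq_zero (fun i hi => ?_), zero_add,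
      deriv_rateV_eq_zero_of_le P ((ht.2.trans (le_add_of_nonneg_right (tHalf_pos _).le))), zero_mul,
      add_zero]
    have hi : i < j := Finset.mem_range.1 hi
    rw [deriv_rateV_eq_zero_of_ge P ((tStart_mono (Nat.succ_le_of_lt hi)).trans
      ((le_add_of_nonneg_right (tHalf_pos _).le).trans ht.1)), zero_mul]
  rw [hH, hV, zero_smul, zero_add]

/-- From `t = 1` on the planar force vanishes. -/
theorem planarForce_of_one_le {t : ℝ} (ht : 1 ≤ t) : planarForce P t = 0 := by
  funext y
  simp [planarForce, not_lt.2 ht]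

/-- From `t = 1` on the lifted force vanishes. -/
theorem liftedForce_of_one_le {t : ℝ} (ht : 1 ≤ t) : liftedForce P t = 0 := by
  show twoHalf (planarForce P t) 0 = 0
  rw [planarForce_of_one_le P ht]
  exact Torus.twoHalf_zero

end Cascade

/-! ## Sizes: the profiles (`|U_j| ≤ 1/(4N_j)`, from the lead's `Rates.abs_U_le`) -/

namespace Cascade

open CascadeParams

variable (P : CascadeParams)

/-- **Amplitude of the profiles**: `|U_j| ≤ 1/(4 N_j)` (`= (π/2)/(2π N_j)`, `Rates.abs_U_le`). -/
theorem abs_U_le {j : ℕ} (hδ : 0 < P.δ j) (hN : 0 < P.N j) (y : ℝ) : |P.U j y| ≤ 1 / (4 * P.N j) := by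
  have hN' : (0 : ℝ) < P.N j := by exact_mod_cast hN
  have h := SawtoothPulseCascade.DriftFreeClosure.Rates.abs_U_le P hδ hN y
  have he : Real.pi / 2 / (2 * Real.pi * (P.N j : ℝ)) = 1 / (4 * (P.N j : ℝ)) := by
    field_simp
    ring
  rwa [he] at h

/-! ## On each half-slot the lifted force is a shear drift on `𝕋³` -/

/-- On the H half-slot of phase `j` the lifted force `(∂ₜū, 0) ∘ π` is the shear drift
`rateH_j′(t) U_j(x₁) e₀` of `DEIJ.drift` (directions `p = 0`, `q = 1`). -/
theorem liftedForce_of_mem_H {j : ℕ} (hδ : 0 < P.δ j) {t : ℝ} (ht : t ∈ Icc (tStart j) (tStart j + tHalf j)) :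
    liftedForce P t =
      Torus.DEIJ.drift (0 : Fin 3) 1 ⟨P.U j, P.U_periodic j, P.contDiff_U hδ⟩ (deriv (P.rateH j) t) := by
  funext x
  rw [Torus.DEIJ.drift_apply]
  have hcoord : P.U j (Torus.repr (planarProj x) 1) =
      Torus.ShearProfile.onCircle ⟨P.U j, P.U_periodic j, P.contDiff_U hδ⟩ (x 1) := by
    have hx : x 1 = (((Torus.repr (planarProj x) 1 : ℝ)) : UnitAddCircle) := by
      have h := congrFun (Torus.proj_repr (planarProj x)) 1
      rw [Torus.proj_apply] at h
      rw [h]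
      rfl
    rw [hx, Torus.ShearProfile.onCircle_coe]
  show twoHalf (planarForce P t) 0 x = _
  rw [planarForce_of_mem_H P ht, ← hcoord]
  ext i
  fin_cases i <;> simp [twoHalf]

/-- On the V half-slot of phase `j` the lifted force is the shear drift `rateV_j′(t) U_j(x₀) e₁`
(directions `p = 1`, `q = 0`). -/
theorem liftedForce_of_mem_V {j : ℕ} (hδ : 0 < P.δ j) {t : ℝ}
    (ht : t ∈ Icc (tStart j + tHalf j) (tStart (j + 1))) :
    liftedForce P t =
      Torus.DEIJ.drift (1 : Fin 3) 0 ⟨P.U j, P.U_periodic j, P.contDiff_U hδ⟩ (deriv (P.rateV j) t) := by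
  funext x
  rw [Torus.DEIJ.drift_apply]
  have hcoord : P.U j (Torus.repr (planarProj x) 0) =
      Torus.ShearProfile.onCircle ⟨P.U j, P.U_periodic j, P.contDiff_U hδ⟩ (x 0) := by
    have hx : x 0 = (((Torus.repr (planarProj x) 0 : ℝ)) : UnitAddCircle) := by
      have h := congrFun (Torus.proj_repr (planarProj x)) 0
      rw [Torus.proj_apply] at h
      rw [h]
      rfl
    rw [hx, Torus.ShearProfile.onCircle_coe]
  show twoHalf (planarForce P t) 0 x = _
  rw [planarForce_of_mem_V P ht, ← hcoord]
  ext i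
  fin_cases i <;> simp [twoHalf]

end Cascade

end Summit.AnomalousDissipation.AnomalousDissipation.Theorems

end
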